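import Summits.MatrixMultiplication.OmegaCensus.SmallFormats.FlipComponent234GF2
import Mathlib.Logic.Relation
import HarnessLib

/-!
# ω-census family (a4): the `𝔽₂` flip component of the Hopcroft–Kerr `⟨2,3,4⟩:20` scheme is finite — `441` schemes, none reducible

Cell `pub-omega` (HOME `run/shared/lean/pub/pub-omega/`, unit `pub-omega-eng2`, ENG2 gen 4), topic
`Summits/MatrixMultiplication/OmegaCensus`.  Framing (verbatim): lottery ticket; floor = certified bounds/negative ranges.
HONEST FRAMING: a kernel-checked FINITE LOCAL FACT about one explicit graph (census row R164 of the cell's table, previously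
certified by two programs: ENG2 `eng2.flipball` and the referee's `check_flip_component_gf2.py`).  It is NOT a lower bound on
`R_{𝔽₂}(⟨2,3,4⟩)` (Kauers–Moosbauer flip graphs become connected only with the extra "plus"/reduction transitions, which are
excluded here), and nothing in this file is progress on `ω`.

## The graph

Vertices: schemes over `𝔽₂` for the format `⟨2,3,4⟩` (`A` is `2×3`, `B` is `3×4`, `C = AB` is `2×4`) with `20` rank-one terms,
a term being a triple of supports `(u, v, w)` (`u ⊆` positions of `A`, `v ⊆` positions of `B`, `w ⊆` positions of `C`) packed as
ONE natural number `p = u + 64·v + 262144·w` with the bit conventions of `SmallFormatMatMulRankUpper.Scheme234` (`u`: bit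
`μ + 3r` = entry `a_{rμ}`; `v`: bit `s + 4μ` = entry `b_{μs}`; `w`: bit `s + 4r` = output `(AB)_{rs}`); a scheme is the SORTED
list of its packed terms (`isort`), i.e. a multiset of terms.
Edges (`flipsP`, the Kauers–Moosbauer FLIP, arXiv:2212.01175 §3, in the move set used by the census: for every pair of terms
`i < j` that agree in one position `P` with a NONZERO common factor, and `Q < R` the two other positions, the two schemes obtained
by the role choices `(a,b) = (i,j)` and `(j,i)`: term `a` gets `Q_a + Q_b` in position `Q`, term `b` gets `R_b − R_a = R_b + R_a`
in position `R` (over `𝔽₂` both are XOR of masks), everything else unchanged — the sum of the two rank-one tensors, hence the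
represented tensor, is unchanged).  A vertex is REDUCIBLE (`reducibleB`, an "`r−1` node") iff some term has an empty factor
(droppable) or two terms agree in two positions (mergeable): exactly the situations in which a flip walk exhibits a scheme with
fewer than `20` terms.

## What is proved (the `decide +kernel` checks live in `FlipComponent234GF2.lean`; this file assembles the statements)

* `X` is COMPUTED inside Lean from the tree-held integer tables `Scheme234.c1/c2/c3` (Hopcroft–Kerr 1971 / catalogue
  `⟨2×3×4:20⟩`, kernel-checked there to be a decomposition of `⟨2,3,4⟩` over every commutative ring) reduced mod `2`.
* `reach_iff_mem` : a scheme is reachable from `X` by flips (`Relation.ReflTransGen` of the neighbour relation)  **iff**  it is one of the `441` schemes of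
  `FlipComponent234GF2Data.L` (closure by the neighbour certificate `cert`; exhaustion by the BFS tree `parent`/`depth`);
* `L_length`, `L_nodup` : these are `441` distinct schemes;
* `not_reducible_of_reach` : no reachable scheme is reducible — so no flip walk from the Hopcroft–Kerr scheme over `𝔽₂`
  ever meets a mergeable pair or a droppable term (no rank-`19` scheme is reachable by flips alone), at ANY distance;
* `flipComponent_HK234_GF2` : the conjunction, as entered in the census (row R164: ENG2 distinct-scheme BFS closure at
  depth `9` ∥ referee from-scratch; here the kernel is the third leg).

## References

* M. Kauers, J. Moosbauer, *Flip graphs for matrix multiplication*, ISSAC 2023, arXiv:2212.01175, §3 (flips, reductions).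
  [KauersMoosbauer2022FlipGraphs]
* J. E. Hopcroft, L. R. Kerr, *On minimizing the number of multiplications necessary for matrix multiplication*, SIAM J. Appl.
  Math. 20 (1971) — the rank-`20` scheme (tree: `SmallFormatMatMulRankUpper.Scheme234`, catalogue entry `⟨2×3×4:20⟩`).
  [HopcroftKerr1971] [SedoglavicFMMCatalogue]
-/

namespace Summit.MatrixMultiplication.OmegaCensus.FlipComponent234GF2

/-! ### From the checks to the statements -/

/-- `L` is closed under the flip relation. -/
theorem closed (s : List ℕ) (hs : s ∈ L) (t : List ℕ) (ht : t ∈ flipsP s) : t ∈ L := by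
  obtain ⟨k, hk, rfl⟩ := exists_nth_of_mem L s hs
  rw [L_length] at hk
  have h := rowK_all k hk
  simp only [rowK, rowOK, Bool.and_eq_true, List.all_eq_true, decide_eq_true_eq, beq_iff_eq] at h
  obtain ⟨hlt, heq⟩ := h
  rw [heq] at ht
  obtain ⟨j, hj, hjt⟩ := List.mem_map.mp ht
  rw [← hjt]
  exact nth_mem L j (by rw [L_length]; exact hlt j hj)

/-- `X ∈ L`. -/
theorem X_mem : X ∈ L := by
  rw [← nth_xIdx]; exact nth_mem L xIdx (by rw [L_length]; decide)

/-- Every reachable scheme is one of the `441`. -/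
theorem mem_of_reach {t : List ℕ} (h : (Relation.ReflTransGen (fun s t : List ℕ => t ∈ flipsP s) X) t) : t ∈ L := by
  induction h with
  | refl => exact X_mem
  | tail _ hst ih => exact closed _ ih _ hst

/-- Every scheme of `L` at BFS depth `d` is reachable (induction on `d` along the BFS tree). -/
theorem reach_of_depth : ∀ (d k : ℕ), k < 441 → nthN depth k = d →
    (Relation.ReflTransGen (fun s t : List ℕ => t ∈ flipsP s) X) (nth L k) := by
  intro d
  induction d with
  | zero =>
    intro k hk hd
    have h := parentOK_of_lt hk
    unfold parentOK at h
    by_cases hkx : k = xIdx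
    · subst hkx
      exact (congrArg (Relation.ReflTransGen (fun s t : List ℕ => t ∈ flipsP s) X) nth_xIdx).mpr
        Relation.ReflTransGen.refl
    · rw [if_neg hkx] at h
      simp only [Bool.and_eq_true, beq_iff_eq, decide_eq_true_eq] at h
      omega
  | succ d ih =>
    intro k hk hd
    have h := parentOK_of_lt hk
    unfold parentOK at h
    by_cases hkx : k = xIdx
    · rw [if_pos hkx] at h
      simp only [Bool.and_eq_true, beq_iff_eq] at h
      omega
    · rw [if_neg hkx] at h
      simp only [Bool.and_eq_true, beq_iff_eq, decide_eq_true_eq] at h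
      obtain ⟨⟨hp, hdep⟩, hmem⟩ := h
      have hpar : (Relation.ReflTransGen (fun s t : List ℕ => t ∈ flipsP s) X) (nth L (nthN parent k)) := ih _ hp (by omega)
      exact Relation.ReflTransGen.tail hpar (List.contains_iff_mem.mp hmem)

/-- Every one of the `441` schemes is reachable. -/
theorem reach_of_mem {t : List ℕ} (ht : t ∈ L) : (Relation.ReflTransGen (fun s t : List ℕ => t ∈ flipsP s) X) t := by
  obtain ⟨j, hj, rfl⟩ := exists_nth_of_mem L t ht
  rw [L_length] at hj
  exact reach_of_depth _ j hj rfl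

/-- **The component.** A scheme is reachable from the Hopcroft–Kerr scheme by flips over `𝔽₂` iff it is one of the `441`
schemes of `L`. -/
theorem reach_iff_mem (t : List ℕ) :
    (Relation.ReflTransGen (fun s t : List ℕ => t ∈ flipsP s) X) t ↔ t ∈ L := ⟨mem_of_reach, reach_of_mem⟩

/-- No scheme of `L` is reducible. -/
theorem not_reducible_of_mem {t : List ℕ} (ht : t ∈ L) : reducibleB t = false := by
  have h := irreducible_check
  rw [List.all_eq_true] at h
  simpa using h t ht

/-- **No `r−1` node is reachable**: no flip walk from the Hopcroft–Kerr `⟨2,3,4⟩:20` scheme over `𝔽₂` ever reaches a scheme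
with a droppable term or a mergeable pair (so none exhibits rank `≤ 19`), at any distance. -/
theorem not_reducible_of_reach {t : List ℕ} (h : (Relation.ReflTransGen (fun s t : List ℕ => t ∈ flipsP s) X) t) : reducibleB t = false :=
  not_reducible_of_mem (mem_of_reach h)

/-- **Census row R164 (kernel leg).** The `𝔽₂` flip component of the Hopcroft–Kerr `⟨2,3,4⟩:20` scheme consists of exactly
the `441` pairwise distinct schemes of `FlipComponent234GF2Data.L`, and none of them is reducible.  (A finite local fact about
this flip graph; NOT a lower bound on `R_{𝔽₂}(⟨2,3,4⟩)`.) -/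
theorem flipComponent_HK234_GF2 :
    (∀ t, (Relation.ReflTransGen (fun s t : List ℕ => t ∈ flipsP s) X) t ↔ t ∈ L) ∧ L.length = 441 ∧ L.Nodup ∧ ∀ t ∈ L, reducibleB t = false :=
  ⟨reach_iff_mem, L_length, L_nodup, fun _ ht => not_reducible_of_mem ht⟩

end Summit.MatrixMultiplication.OmegaCensus.FlipComponent234GF2
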